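import Summits.NavierStokesRegularity.NavierStokesRegularity.Cruxes.BoundedTemperatureClosed.Disproof

/-!
# Sketch — crux-ideate round 2, ideator k = 4, crux stmt-NavierStokesRegularity-18303
`BoundedTemperatureClosed` (route PumpContinuation)

First lemmas / typed targets of the two round-2 idea cards of ideator 4:

* card `gkp-critical-temperature` — the crux is an ATTAINMENT problem (kernel fact
  `isClosed_btSet_iff_not_typeIInfimumNotAttainedNS`, p150539); this file splits the attainment
  content into three NAMED pieces none of which is `Attain` verbatim:
  `TradeoffNS` (near-minimal witnesses WLOG inside one energy budget) →
  `BudgetedAttainNS` (GKP critical-element extraction for the temperature functional: EXACT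
  attainment inside a budget, over `H¹⁰_df` data) →
  `SchwartzSaturationNS` (lossless Schwartz upgrade) → `¬ TypeIInfimumNotAttainedNS`
  (`not_typeIInfimumNotAttainedNS_of_split`, proved); and the ∀𝒜 transfer
  `crux_of_relaxed : schwartzData ⊆ 𝒳 → RelaxedClosedIn 𝒳 → SchwartzSaturationIn 𝒳 → crux` (proved).
* card `signed-terminal-descent` — first lemma `DenseMeetsFiniteCodim` (pure functional
  analysis, Mathlib-typable, provable now): a dense subspace meets every finite-codimension
  `C¹` zero set near a regular point — the brick that puts SCHWARTZ data on the finite-codimension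
  sub-κ (signed-descent) manifold of a relaxed minimiser, i.e. the typed home of
  `SchwartzSaturationIn`.

Nothing here is a skeleton; no `sorry`.
-/

noncomputable section

open MeasureTheory Set Filter Topology
open scoped ENNReal
open Literature.Analysis.FluidPDE Literature.Analysis.FluidPDE.Tao2016
open Summit.NavierStokesRegularity.NavierStokesRegularity.Cruxes.BoundedTemperatureClosed.Disproof
  (segForm btSet boundedTemperatureClosed_iff NSTypeICeiling TypeIInfimumNotAttainedNS)

-- nested summit namespace is the tree layout (D-0017)
set_option linter.dupNamespace false

namespace Summit.NavierStokesRegularity.NavierStokesRegularity.Cruxes.BoundedTemperatureClosed.IdeasK4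

/-! ### The crux's membership predicate over an arbitrary data class `𝒳 ⊆ L²(ℝ³; ℂ³)` -/

/-- `a : L2C` is the datum of an `H¹⁰_df`-mild Type-I(`M`) blow-up of the form `T`: a mild solution on
`[0,S)` with `‖u t‖_∞ ≤ M/√(S-t)` and no mild extension past `S` (verbatim body of the crux, datum
abstracted). -/
def IsTypeIWitness (T : L2C → L2C → L2C → ℂ) (M : ℝ) (a : L2C) : Prop :=
  ∃ S : ℝ, 0 < S ∧ ∃ u : ℝ → L2C, IsMildSolutionFor T a (Ico 0 S) u ∧
    (∀ t ∈ Ico 0 S, eLpNorm (u t) ⊤ volume ≤ ENNReal.ofReal (M / Real.sqrt (S - t))) ∧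
    ¬ ∃ S' : ℝ, S < S' ∧ ∃ v : ℝ → L2C, IsMildSolutionFor T a (Ico 0 S') v ∧ ∀ t ∈ Ico 0 S, v t = u t

/-- The bounded-temperature blow-up set of a `θ`-family of forms with data ranging over `𝒳`. -/
def btSetIn (𝒳 : Set L2C) (T : ℝ → L2C → L2C → L2C → ℂ) (M : ℝ) : Set ℝ :=
  {θ : ℝ | θ ∈ Icc (0 : ℝ) 1 ∧ ∃ a ∈ 𝒳, IsTypeIWitness (T θ) M a}

/-- The crux's own data class: complexified divergence-free Schwartz fields. -/
def schwartzData : Set L2C :=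
  {a | ∃ u₀ : SchwartzMap (EuclideanSpace ℝ (Fin 3)) (EuclideanSpace ℝ (Fin 3)),
    VectorCalculus.IsDivFree ⇑u₀ ∧ a = schwartzL2 u₀}

/-- The RELAXED data class of card `gkp-critical-temperature`: all of Tao's `H¹⁰_df` (the natural
domain of the mild formulation; weak/profile limits re-enter it after an instantaneous time shift). -/
def h10Data : Set L2C := {a | MemH10df a}

theorem btSetIn_mono {𝒳 𝒴 : Set L2C} (h : 𝒳 ⊆ 𝒴) (T : ℝ → L2C → L2C → L2C → ℂ) (M : ℝ) :
    btSetIn 𝒳 T M ⊆ btSetIn 𝒴 T M := by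
  rintro θ ⟨hθ, a, ha, hw⟩
  exact ⟨hθ, a, h ha, hw⟩

/-- The crux's set is the Schwartz-data instance of `btSetIn` (definitional bookkeeping). -/
theorem mem_btSet_iff_mem_btSetIn (T : ℝ → L2C → L2C → L2C → ℂ) (M θ : ℝ) :
    θ ∈ btSet T M ↔ θ ∈ btSetIn schwartzData T M := by
  simp only [btSet, btSetIn, schwartzData, IsTypeIWitness, mem_setOf_eq]
  constructor
  · rintro ⟨hθ, u₀, hdiv, hrest⟩
    exact ⟨hθ, schwartzL2 u₀, ⟨u₀, hdiv, rfl⟩, hrest⟩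
  · rintro ⟨hθ, a, ⟨u₀, hdiv, rfl⟩, hrest⟩
    exact ⟨hθ, u₀, hdiv, hrest⟩

theorem btSet_eq_btSetIn (T : ℝ → L2C → L2C → L2C → ℂ) (M : ℝ) :
    btSet T M = btSetIn schwartzData T M :=
  Set.ext (mem_btSet_iff_mem_btSetIn T M)

/-! ### The ∀𝒜 transfer of card `gkp-critical-temperature`: relaxed closedness + Schwartz saturation -/

/-- **Relaxed closedness**: the crux with data ranging over `𝒳` instead of Schwartz fields. For
`𝒳 = h10Data` its attainment content is a GKP-type critical-element statement (exact attainment of a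
sup-in-time critical functional inside a weakly closed, budgeted class), not `Attain`. -/
def RelaxedClosedIn (𝒳 : Set L2C) : Prop :=
  ∀ 𝒜 : AveragingDatum, 𝒜.IsSymmetric → 𝒜.HasCancellation → ∀ M : ℝ,
    IsClosed (btSetIn 𝒳 (segForm 𝒜) M)

/-- **Schwartz saturation**: every `𝒳`-datum bounded-temperature blow-up is matched, at the SAME
operator and the SAME ceiling, by a Schwartz-datum one (lossless ignition; card
`signed-terminal-descent` supplies the mechanism: first-order signed descent of the temperature on the
finite-codimension blow-up manifold + `DenseMeetsFiniteCodim`). -/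
def SchwartzSaturationIn (𝒳 : Set L2C) : Prop :=
  ∀ 𝒜 : AveragingDatum, 𝒜.IsSymmetric → 𝒜.HasCancellation → ∀ M : ℝ,
    btSetIn 𝒳 (segForm 𝒜) M ⊆ btSet (segForm 𝒜) M

/-- **Transfer (proved).** For any data class containing the Schwartz data, relaxed closedness plus
Schwartz saturation give the crux BY NAME: the two sets coincide, and one of them is closed. -/
theorem crux_of_relaxed {𝒳 : Set L2C} (h𝒳 : schwartzData ⊆ 𝒳) (hcl : RelaxedClosedIn 𝒳)
    (hsat : SchwartzSaturationIn 𝒳) : Theses.PumpContinuation.BoundedTemperatureClosed := by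
  rw [boundedTemperatureClosed_iff]
  intro 𝒜 hs hc M
  have heq : btSet (segForm 𝒜) M = btSetIn 𝒳 (segForm 𝒜) M := by
    apply Subset.antisymm
    · rw [btSet_eq_btSetIn]
      exact btSetIn_mono h𝒳 _ _
    · exact hsat 𝒜 hs hc M
  rw [heq]
  exact hcl 𝒜 hs hc M

/-- Schwartz divergence-free data are `H¹⁰_df` data … stated as the hypothesis it is used as (the tree
proves `MemH10df (schwartzL2 u₀)` for divergence-free `u₀` inside the PerpetualPump files; not re-derived). -/
def SchwartzSubH10 : Prop := schwartzData ⊆ h10Data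

/-- The card's line for the crux as filed, in one implication (proved): -/
theorem crux_of_relaxedH10 (h0 : SchwartzSubH10) (hcl : RelaxedClosedIn h10Data)
    (hsat : SchwartzSaturationIn h10Data) : Theses.PumpContinuation.BoundedTemperatureClosed :=
  crux_of_relaxed h0 hcl hsat

/-! ### Zero datum: the three-way split of `¬ TypeIInfimumNotAttainedNS` (answer to O1 in Lean) -/

/-- Energy-budgeted NS Type-I ceiling over `H¹⁰_df` data: an `H¹⁰_df` datum `a` with
`‖a‖²_{L²} ≤ E·√S` (the scale-invariant energy budget at blow-up time `S`) carrying an `H¹⁰_df`-mild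
Type-I(`K`) blow-up of the true Navier–Stokes form with no mild extension. -/
def NSTypeICeilingBudget (K E : ℝ) : Prop :=
  ∃ a : L2C, MemH10df a ∧ ∃ S : ℝ, 0 < S ∧ ‖a‖ ^ 2 ≤ E * Real.sqrt S ∧ ∃ u : ℝ → L2C,
    IsMildSolutionFor eulerForm a (Ico 0 S) u ∧
    (∀ t ∈ Ico 0 S, eLpNorm (u t) ⊤ volume ≤ ENNReal.ofReal (K / Real.sqrt (S - t))) ∧
    ¬ ∃ S' : ℝ, S < S' ∧ ∃ v : ℝ → L2C, IsMildSolutionFor eulerForm a (Ico 0 S') v ∧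
      ∀ t ∈ Ico 0 S, v t = u t

/-- **Tradeoff (energy–temperature)**: if Navier–Stokes has Schwartz-data mild Type-I blow-ups at
every ceiling `K' > K`, then inside ONE energy budget `E` it has `H¹⁰_df`-data ones at every ceiling
`K' > K` (near-minimal witnesses do not need unbounded energy: `HasCancellation` ⇒ blow-up needs scale
transfer ⇒ bounded effective extent; far field removable by wide-return solenoidal surgery at vanishing
sup- and energy-cost, then finite-codimension re-tuning). FALSE in the semilinear heat equation (no
cancellation: the coldest blow-up there is the flat ODE solution); the load-bearing use of
`HasCancellation` whose status Disproof §(a)/(f) left open. -/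
def TradeoffNS : Prop :=
  ∀ K : ℝ, 0 < K → (∀ K' : ℝ, K < K' → NSTypeICeiling K') →
    ∃ E : ℝ, 0 < E ∧ ∀ K' : ℝ, K < K' → NSTypeICeilingBudget K' E

/-- **Budgeted attainment = FIRST LEMMA of card `gkp-critical-temperature`** (GKP 2016 Prop. 2.1
transplanted from `sup_t ‖u(t)‖_{Ḃ^{s_p}_{p,p}}` to the temperature `sup_t √(S-t)‖u(t)‖_∞`): inside a
fixed energy budget the infimal Type-I ceiling of Navier–Stokes over `H¹⁰_df` data is ATTAINED (up to
doubling the budget for the instantaneous time shift that puts the limit profile back into `H¹⁰_df`).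
Mechanism: the `L^∞` ceiling at `t = 0` forbids concentrating profiles, the `L²` budget forbids energetic
spreading ones, so a minimising sequence (blow-up time normalised to `1`) profile-decomposes at UNIT
scale; by nonlinear decoupling the first-blowing profile blows up at a time `≤ 1` with temperature
`≤ K` (`‖·‖_∞` is weak-* l.s.c. and an EARLIER blow-up time only lowers `√(S-t)`); it is the
minimiser — exact, because the budgeted class is weakly closed. Pure harmonic analysis + translation
invariance of `B`. -/
def BudgetedAttainNS : Prop :=
  ∀ K E : ℝ, 0 < K → 0 < E → (∀ K' : ℝ, K < K' → NSTypeICeilingBudget K' E) →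
    NSTypeICeilingBudget K (2 * E)

/-- **Schwartz saturation at the zero datum** (card `signed-terminal-descent`): a budgeted `H¹⁰_df`
witness at ceiling `K` is matched by a Schwartz witness at the SAME ceiling (no `η`-loss). -/
def SchwartzSaturationNS : Prop :=
  ∀ K E : ℝ, 0 < K → NSTypeICeilingBudget K E → NSTypeICeiling K

/-- **O1 answered in Lean.** The registered open statement `H = TypeIInfimumNotAttainedNS` (p146867) is
refuted by the conjunction of the three named pieces — and by no single one of them: this is where the
card's line carries `¬H` at the zero datum (Sketch-dead.md O1), split into budget-WLOG (Tradeoff),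
exact attainment inside a budget (GKP engine) and lossless Schwartz upgrade (signed descent). -/
theorem not_typeIInfimumNotAttainedNS_of_split (h1 : TradeoffNS) (h2 : BudgetedAttainNS)
    (h3 : SchwartzSaturationNS) : ¬ TypeIInfimumNotAttainedNS := by
  rintro ⟨K, hK, hnot, hall⟩
  obtain ⟨E, hE, hbud⟩ := h1 K hK hall
  exact hnot (h3 K (2 * E) hK (h2 K E hK hE hbud))

/-! ### First lemma of card `signed-terminal-descent`: dense subspaces meet finite-codimension zero sets -/

/-- **Dense-meets-finite-codimension lemma** (pure functional analysis; provable now from the inverse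
function theorem / Brouwer on a `k`-dimensional affine slice chosen INSIDE the dense subspace, which is
possible because surjectivity of `DF(x₀)` restricted to a subspace is an open condition): if `D` is a
dense linear subspace of a Banach space `E` and `F : E → ℝᵏ` is `C¹` with `F x₀ = 0` and `DF(x₀)`
onto, then `D` contains zeros of `F` arbitrarily close to `x₀`. Use: `D` = (complexified div-free)
Schwartz fields inside the data space, `F` = the `k` spectral/sign constraints cutting the sub-κ
(one-signed terminal approach) stable manifold of a relaxed minimiser; conclusion = a SCHWARTZ datum on
that manifold, i.e. a lossless ignition. -/
def DenseMeetsFiniteCodim : Prop :=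
  ∀ (E : Type) [NormedAddCommGroup E] [NormedSpace ℝ E] [CompleteSpace E] (k : ℕ)
    (D : Submodule ℝ E), Dense (D : Set E) →
    ∀ (F : E → EuclideanSpace ℝ (Fin k)) (x₀ : E), ContDiff ℝ 1 F → F x₀ = 0 →
      Function.Surjective (fderiv ℝ F x₀) →
      ∀ ε : ℝ, 0 < ε → ∃ d : E, d ∈ D ∧ dist d x₀ < ε ∧ F d = 0

/-- Sanity (the `k = 0` slice of the lemma is density itself). -/
theorem denseMeetsFiniteCodim_zero (E : Type) [NormedAddCommGroup E] [NormedSpace ℝ E]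
    (D : Submodule ℝ E) (hD : Dense (D : Set E)) (F : E → EuclideanSpace ℝ (Fin 0)) (x₀ : E)
    (ε : ℝ) (hε : 0 < ε) : ∃ d : E, d ∈ D ∧ dist d x₀ < ε ∧ F d = 0 := by
  obtain ⟨d, hd, hdD⟩ := Metric.dense_iff.1 hD x₀ ε hε
  exact ⟨d, hdD, by simpa [dist_comm] using Metric.mem_ball.1 hd, Subsingleton.elim _ _⟩

end Summit.NavierStokesRegularity.NavierStokesRegularity.Cruxes.BoundedTemperatureClosed.IdeasK4

end
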